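import Literature.AlgebraicGeometry.HodgeTheory.BettiHodgeConjectureProductsOffMiddleAlgebraicFactor
import Literature.AlgebraicGeometry.HodgeTheory.BettiKunnethHodgeClassesAlgebraicClasses
import HarnessLib

/-!
# A Künneth piece `H^{2a}(Y) ⊗ H^{2b}(Z)` without exceptional Hodge classes (`dim Hdg^{a+b} ≤ ρₐ(Y)·ρ_b(Z)`, i.e. `dim Hom_HS(H^{2a}Y, H^{2b}Z(b−a)) ≤ ρₐρ_b`) has algebraic Hodge classes;
# `HC(Y × Z)` for two off-middle-algebraic varieties of even dimensions `2h`, `2h'` with `dim Hom_HS(H^{2h}Y, H^{2h'}Z(h'−h)) ≤ ρ_h(Y)·ρ_{h'}(Z)`; pairs of even-dimensional smooth hypersurfaces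
# (Voisin I §11.3.3 Thm. 11.38, Lemma 11.41, p. 287; Voisin II §1.2.3 Cor. 1.24–1.25, §9.2.4 Prop. 9.20)

Family `hodge`, lane `lit-hodgefound` (Track 2 foundations library; Layers A1/A4), layer `Literature/AlgebraicGeometry/HodgeTheory`.  THEOREMS ONLY (no definition, no named fact, no instance;
D-0026 net debt `0`).  Sequel of the seat's g27-#1 (`BettiKunnethHodgeClassesAlgebraicClasses`: `dim Hdgᵃ(H^{2a}Y)·dim Hdgᵇ(H^{2b}Z) ≤ dim Hdg^{a+b}(H^{2a}Y ⊗ H^{2b}Z)`, and the GLOBAL count criterion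
`HC(Y ⊗ Z) ⟸ ∀ p, dim Hdgᵖ(H^{2p}(Y ⊗ Z)) = Σ dim Hdgᵃ·dim Hdgᵇ`), g29-#7 (`BettiHodgeConjectureProductsOffMiddleAlgebraicFactor`: with both factors off-middle algebraic only the piece `Hᵐ(Y) ⊗ Hⁿ(Z)`
matters) and g29-#8 (squares in even dimension).  Here the count is run ON ONE PIECE: if the piece `H^{2a}(Y) ⊗ H^{2b}(Z)` carries no more Hodge classes than the products `Hdgᵃ ⊗ Hdgᵇ` (equivalently,
Lemma 11.41, `dim Hom_HS(H^{2a}Y, H^{2b}Z(b − a)) ≤ ρₐ(Y)ρ_b(Z)`), then its Hodge classes ARE `Hdgᵃ(Y) ⊗ Hdgᵇ(Z)` and their cross products are exterior products of algebraic classes.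

WHAT IS PROVED.
* §1 **`BettiUniverse.ofRatClass_crossMap_mem_algebraicClasses_of_finrank_hodgeClasses_le_mul`** (the piece `(2a, 2b)`: `dim Hdg^{a+b}(piece) ≤ dim Hdgᵃ·dim Hdgᵇ`, Hodge classes of the factors
  algebraic ⇒ algebraic cross products) and its `Hom` form **`…_of_finrank_hom_le_mul`** (`dim Hom_HS(H^{2a}Y, H^{2b}Z(b−a)) ≤ dim Hdgᵃ·dim Hdgᵇ`).
* §2 **`BettiUniverse.hodgeConjectureFor_tensor_of_offMiddle_algebraic_of_finrank_hom_le_mul`**: `Y`, `Z` off-middle algebraic of EVEN dimensions `m = 2h`, `n = 2h'` with `HC(Y)`, `HC(Z)` and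
  `dim Hom_HS(HᵐY, HⁿZ(h' − h)) ≤ ρ_h(Y)·ρ_{h'}(Z)` ⇒ `HC(Y × Z)` (g29-#7's two-sided criterion + §1 on the piece `(m, n)`).
* §3 **`IsSmoothHypersurface.hodgeConjectureFor_tensor_hypersurface_of_even_of_even_of_finrank_hom_le_mul`**: two smooth hypersurfaces `Y ⊂ ℙ^{2h+1}`, `Y' ⊂ ℙ^{2h'+1}` of even dimensions with
  `HC(Y)`, `HC(Y')` and `dim Hom_HS(H^{2h}Y, H^{2h'}Y'(h' − h)) ≤ ρ_h(Y)·ρ_{h'}(Y')` (no exceptional morphism between the middle cohomologies — e.g. two cubic fourfolds whose transcendental parts are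
  not Hodge-isometric up to twist) satisfy `HC(Y × Y')` (Voisin II Cor. 1.24/1.25 via g29-#7).

THE PRINTS.  C. Voisin (2002) [VoisinHodgeI2002] §11.3.3 Thm. 11.38 (Künneth and bidegrees), Thm. 11.40 and p. 287 (Künneth components of Hodge classes; the graph classes of morphisms of Hodge structures
are the exceptional Hodge classes), Lemma 11.41 (`Hdg(Hᵏ ⊗ Hˡ) ↔ Hom_HS`).  C. Voisin (2003) [VoisinHodgeII2003] §1.2.3 Cor. 1.24–1.25, §9.2.4 proof of Prop. 9.20.  K. Hulek, R. Laface (2019)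
[HulekLaface2019PicardNumbersAV] §2.1 Prop. 2.2 (the count `ρ(A × B) = ρ(A) + ρ(B) + rank Hom`, the model of «exceptional classes»).  P. Deligne (2000/2006) [Deligne2000] §1.

THE OBJECTS (all the tree's).  `Y Z Y' : SchemeOver ℂ`, `IsSmoothProjective`, `IsSmoothHypersurface`; `hHD : exists_isReal_hodgeModel`; `Hᵏ(X) = BettiUniverse.hodge hHD hX k`, `hodgeClasses`,
`HodgeStructure.Hom`, `tensor`, `tateTwist`, `cast`; `BettiUniverse.kunnethSummand`, `BettiUniverse.crossMap`; `TensorProduct.mapIncl`; `bettiCohomology`, `ofRatClass`, `algebraicClasses`,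
`HodgeConjectureFor`.

DEVIATIONS / SCOPE.  Only the inequality `≤` is a hypothesis (the reverse inequality is g27-#1); odd-dimensional pairs are g29-#7 (`…_of_subsingleton_hom`).  No definitions.

## References
* [VoisinHodgeI2002] C. Voisin, *Hodge Theory and Complex Algebraic Geometry I* (2002) — §11.3.3 Thm. 11.38, Thm. 11.40, Lemma 11.41, p. 287.
* [VoisinHodgeII2003] C. Voisin, *Hodge Theory and Complex Algebraic Geometry II* (2003) — §1.2.3 Cor. 1.24–1.25; §9.2.4 Prop. 9.20.
* [HulekLaface2019PicardNumbersAV] K. Hulek, R. Laface, *On the Picard numbers of abelian varieties* (2019) — §2.1 Prop. 2.2.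
* [Deligne2000] P. Deligne, *The Hodge conjecture* (Clay problem description) — §1.

## Provenance
Lane `lit-hodgefound` (Hodge path, Track 2), prover seat `lit-hodgefound-p29` (generation 29), self-proposed row g29-#9 (the piecewise count; two even-dimensional factors).
-/

noncomputable section

open scoped TensorProduct
open CategoryTheory MonoidalCategory Module Finset
open Literature.AlgebraicTopology.SingularHomology
open Literature.Geometry.Kaehler

namespace Literature.AlgebraicGeometry.HodgeTheory

open Literature.AlgebraicGeometry.Motives
open Literature.AlgebraicGeometry.Motives.HodgeStructure

variable {m n d : ℕ} {X Y Z : SchemeOver ℂ}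

/-! ### §1 A piece without exceptional Hodge classes -/

section Piece

variable [HodgeTensorFacts.{0, 0}]

/-- **A piece `H^{2a}(Y) ⊗ H^{2b}(Z)` with `dim_ℚ Hdg^{a+b}(H^{2a}Y ⊗ H^{2b}Z) ≤ dim_ℚ Hdgᵃ(H^{2a}Y) · dim_ℚ Hdgᵇ(H^{2b}Z)` has Hodge classes `= Hdgᵃ ⊗ Hdgᵇ`**, so — when the Hodge classes of the factors
have algebraic complexification — every Hodge class of the piece has ALGEBRAIC cross product (exterior products of algebraic classes, proof of Prop. 9.20).  The reverse inequality always holds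
(Thm. 11.38: `Hdgᵃ ⊗ Hdgᵇ ↪ Hdg^{a+b}`, g27-#1), so the hypothesis says «no exceptional Hodge class on this piece» (p. 287). [cite: VoisinHodgeI2002, §11.3.3 Thm. 11.38 and p. 287] [cite: VoisinHodgeII2003, §9.2.4 proof of Prop. 9.20] -/
theorem BettiUniverse.ofRatClass_crossMap_mem_algebraicClasses_of_finrank_hodgeClasses_le_mul (hHD : exists_isReal_hodgeModel) (hY : IsSmoothProjective m Y) (hZ : IsSmoothProjective n Z)
    {a b c : ℕ} (hc : 2 * a + 2 * b = 2 * c)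
    (hYalg : ∀ u ∈ (BettiUniverse.hodge hHD hY (2 * a)).hodgeClasses a, ofRatClass (ComplexPoints Y) (2 * a) u ∈ algebraicClasses Y a)
    (hZalg : ∀ w ∈ (BettiUniverse.hodge hHD hZ (2 * b)).hodgeClasses b, ofRatClass (ComplexPoints Z) (2 * b) w ∈ algebraicClasses Z b)
    (hle : Module.finrank ℚ ↥((BettiUniverse.kunnethSummand hHD hY hZ (2 * c) ⟨(2 * a, 2 * b), HasAntidiagonal.mem_antidiagonal.2 hc⟩).hodgeClasses c) ≤
      Module.finrank ℚ ↥((BettiUniverse.hodge hHD hY (2 * a)).hodgeClasses a) * Module.finrank ℚ ↥((BettiUniverse.hodge hHD hZ (2 * b)).hodgeClasses b))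
    {t : bettiCohomology Y (2 * a) ⊗[ℚ] bettiCohomology Z (2 * b)} (ht : t ∈ (BettiUniverse.kunnethSummand hHD hY hZ (2 * c) ⟨(2 * a, 2 * b), HasAntidiagonal.mem_antidiagonal.2 hc⟩).hodgeClasses c) :
    ofRatClass (ComplexPoints (Y ⊗ Z)) (2 * c) (BettiUniverse.crossMap Y Z hc t) ∈ algebraicClasses (Y ⊗ Z) c := by
  obtain rfl : c = a + b := by omega
  haveI := BettiUniverse.finite hY (2 * a)
  haveI := BettiUniverse.finite hZ (2 * b)
  set NA := (BettiUniverse.hodge hHD hY (2 * a)).hodgeClasses (a : ℤ) with hNA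
  set NB := (BettiUniverse.hodge hHD hZ (2 * b)).hodgeClasses (b : ℤ) with hNB
  set P₀ : Submodule ℚ (bettiCohomology Y (2 * a) ⊗[ℚ] bettiCohomology Z (2 * b)) := LinearMap.range (TensorProduct.mapIncl NA NB) with hP₀
  have hidx : (((a + b : ℕ)) : ℤ) = (a : ℤ) + b := by push_cast; ring
  have hP₀le : P₀ ≤ ((BettiUniverse.hodge hHD hY (2 * a)).tensor (BettiUniverse.hodge hHD hZ (2 * b))).hodgeClasses (((a + b : ℕ)) : ℤ) := by
    rw [hP₀, TensorProduct.range_mapIncl, Submodule.map₂_le]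
    intro y hy z hz
    have hyz := HodgeStructure.tmul_mem_hodgeClasses_tensor _ _ hy hz
    rw [← hidx] at hyz
    exact hyz
  haveI : Module.Free ℚ ↥NA := Module.Free.of_divisionRing ℚ _
  haveI : Module.Free ℚ ↥NB := Module.Free.of_divisionRing ℚ _
  have hP₀rank : Module.finrank ℚ ↥P₀ = Module.finrank ℚ ↥NA * Module.finrank ℚ ↥NB := by
    rw [hP₀, LinearMap.finrank_range_of_inj (Module.Flat.tensorProduct_mapIncl_injective_of_right _ _), Module.finrank_tensorProduct]
  have hle' : Module.finrank ℚ ↥(((BettiUniverse.hodge hHD hY (2 * a)).tensor (BettiUniverse.hodge hHD hZ (2 * b))).hodgeClasses (((a + b : ℕ)) : ℤ)) ≤ Module.finrank ℚ ↥P₀ := by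
    rw [hP₀rank]
    have e := hle
    rw [BettiUniverse.kunnethSummand, HodgeStructure.cast_hodgeClasses] at e
    exact e
  have hPeq : P₀ = ((BettiUniverse.hodge hHD hY (2 * a)).tensor (BettiUniverse.hodge hHD hZ (2 * b))).hodgeClasses (((a + b : ℕ)) : ℤ) := Submodule.eq_of_le_of_finrank_le hP₀le hle'
  have ht' : t ∈ P₀ := by
    rw [hPeq]
    change t ∈ (((BettiUniverse.hodge hHD hY (2 * a)).tensor (BettiUniverse.hodge hHD hZ (2 * b))).cast _).hodgeClasses _ at ht
    rw [HodgeStructure.cast_hodgeClasses] at ht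
    exact ht
  rw [hP₀] at ht'
  obtain ⟨w, rfl⟩ := ht'
  clear ht
  induction w using TensorProduct.induction_on with
  | zero => rw [map_zero, map_zero, map_zero]; exact Submodule.zero_mem _
  | tmul p q =>
    rw [TensorProduct.mapIncl, TensorProduct.map_tmul, Submodule.subtype_apply, Submodule.subtype_apply]
    have hpq := BettiUniverse.ofRatClass_crossMap_tmul_mem_algebraicClasses hY hZ (hYalg p p.2) (hZalg q q.2)
    exact hpq
  | add x y hx hy => rw [map_add, map_add, map_add]; exact Submodule.add_mem _ hx hy

/-- **`Hom` form**: `dim_ℚ Hom_HS(H^{2a}Y, H^{2b}Z(b − a)) ≤ dim_ℚ Hdgᵃ(H^{2a}Y) · dim_ℚ Hdgᵇ(H^{2b}Z)` (Lemma 11.41: `dim Hdg^{a+b}(H^{2a}Y ⊗ H^{2b}Z) = dim Hom_HS(H^{2a}Y, H^{2b}Z(b − a))` on the lane's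
polarizable carriers) ⇒ every Hodge class of the piece has algebraic cross product. [cite: VoisinHodgeI2002, §11.3.3 Lemma 11.41 and p. 287] [cite: VoisinHodgeII2003, §9.2.4 proof of Prop. 9.20] -/
theorem BettiUniverse.ofRatClass_crossMap_mem_algebraicClasses_of_finrank_hom_le_mul (hHD : exists_isReal_hodgeModel) (hY : IsSmoothProjective m Y) (hZ : IsSmoothProjective n Z)
    {a b c : ℕ} (hc : 2 * a + 2 * b = 2 * c) (hs : (((2 * b : ℕ)) : ℤ) - 2 * ((b : ℤ) - a) = ((2 * a : ℕ) : ℤ))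
    (hYalg : ∀ u ∈ (BettiUniverse.hodge hHD hY (2 * a)).hodgeClasses a, ofRatClass (ComplexPoints Y) (2 * a) u ∈ algebraicClasses Y a)
    (hZalg : ∀ w ∈ (BettiUniverse.hodge hHD hZ (2 * b)).hodgeClasses b, ofRatClass (ComplexPoints Z) (2 * b) w ∈ algebraicClasses Z b)
    (hle : Module.finrank ℚ (HodgeStructure.Hom (BettiUniverse.hodge hHD hY (2 * a)) (((BettiUniverse.hodge hHD hZ (2 * b)).tateTwist ((b : ℤ) - a)).cast hs)) ≤
      Module.finrank ℚ ↥((BettiUniverse.hodge hHD hY (2 * a)).hodgeClasses a) * Module.finrank ℚ ↥((BettiUniverse.hodge hHD hZ (2 * b)).hodgeClasses b))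
    {t : bettiCohomology Y (2 * a) ⊗[ℚ] bettiCohomology Z (2 * b)} (ht : t ∈ (BettiUniverse.kunnethSummand hHD hY hZ (2 * c) ⟨(2 * a, 2 * b), HasAntidiagonal.mem_antidiagonal.2 hc⟩).hodgeClasses c) :
    ofRatClass (ComplexPoints (Y ⊗ Z)) (2 * c) (BettiUniverse.crossMap Y Z hc t) ∈ algebraicClasses (Y ⊗ Z) c := by
  refine BettiUniverse.ofRatClass_crossMap_mem_algebraicClasses_of_finrank_hodgeClasses_le_mul hHD hY hZ hc hYalg hZalg ?_ ht
  have e := BettiUniverse.finrank_hodgeClasses_tensor_hodge_eq_finrank_hom_tateTwist hHD hY hZ (2 * a) (2 * b) hs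
  rw [show (((2 * a : ℕ)) : ℤ) + ((b : ℤ) - a) = ((c : ℕ) : ℤ) by push_cast; omega] at e
  rw [BettiUniverse.kunnethSummand, HodgeStructure.cast_hodgeClasses, e]
  exact hle

end Piece

/-! ### §2 Two off-middle-algebraic factors of even dimensions -/

/-- **`HC(Y × Z)` for `Y`, `Z` off-middle algebraic of EVEN dimensions `m = 2h`, `n = 2h'` with `HC(Y)`, `HC(Z)` and `dim_ℚ Hom_HS(HᵐY, HⁿZ(h' − h)) ≤ ρ_h(Y) · ρ_{h'}(Z)`** (`ρ_h(Y) = dim_ℚ Hdgʰ(HᵐY)`):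
only the piece `Hᵐ(Y) ⊗ Hⁿ(Z)` matters (g29-#7) and it carries no exceptional Hodge class (§1). [cite: VoisinHodgeI2002, §11.3.3 Thm. 11.38–11.40, Lemma 11.41 and p. 287] [cite: VoisinHodgeII2003, §9.2.4 proof of Prop. 9.20]
[cite: Deligne2000, §1] -/
theorem BettiUniverse.hodgeConjectureFor_tensor_of_offMiddle_algebraic_of_finrank_hom_le_mul (hHD : exists_isReal_hodgeModel) (hY : IsSmoothProjective m Y) (hZ : IsSmoothProjective n Z)
    (hYZ : IsSmoothProjective d (Y ⊗ Z)) (hHCY : HodgeConjectureFor m Y) (hHCZ : HodgeConjectureFor n Z) {h h' : ℕ} (hm : m = 2 * h) (hn : n = 2 * h')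
    (hoddY : ∀ k, Odd k → Module.finrank ℚ (bettiCohomology Y k) = 0) (hevenY : ∀ p, 2 * p ≠ m → (BettiUniverse.hodge hHD hY (2 * p)).hodgeClasses p = ⊤)
    (hoddZ : ∀ k, Odd k → Module.finrank ℚ (bettiCohomology Z k) = 0) (hevenZ : ∀ p, 2 * p ≠ n → (BettiUniverse.hodge hHD hZ (2 * p)).hodgeClasses p = ⊤)
    (hs : (n : ℤ) - 2 * ((h' : ℤ) - h) = m)
    (hle : Module.finrank ℚ (HodgeStructure.Hom (BettiUniverse.hodge hHD hY m) (((BettiUniverse.hodge hHD hZ n).tateTwist ((h' : ℤ) - h)).cast hs)) ≤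
      Module.finrank ℚ ↥((BettiUniverse.hodge hHD hY m).hodgeClasses h) * Module.finrank ℚ ↥((BettiUniverse.hodge hHD hZ n).hodgeClasses h')) :
    HodgeConjectureFor d (Y ⊗ Z) := by
  haveI : HodgeTensorFacts.{0, 0} := hodgeTensorFacts_holds
  subst hm
  subst hn
  have halgY : ∀ (p : ℕ), ∀ z ∈ (BettiUniverse.hodge hHD hY (2 * p)).hodgeClasses (p : ℤ), ofRatClass (ComplexPoints Y) (2 * p) z ∈ algebraicClasses Y p :=
    fun p z hz ↦ hHCY.2 p _ (isRationalClass_ofRatClass _) ((BettiUniverse.mem_hodgeClasses_hodge_iff_isOfHodgeType hHD hY p z).1 hz)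
  have halgZ : ∀ (p : ℕ), ∀ z ∈ (BettiUniverse.hodge hHD hZ (2 * p)).hodgeClasses (p : ℤ), ofRatClass (ComplexPoints Z) (2 * p) z ∈ algebraicClasses Z p :=
    fun p z hz ↦ hHCZ.2 p _ (isRationalClass_ofRatClass _) ((BettiUniverse.mem_hodgeClasses_hodge_iff_isOfHodgeType hHD hZ p z).1 hz)
  refine BettiUniverse.hodgeConjectureFor_tensor_of_offMiddle_algebraic hHD hY hZ hYZ hHCY hHCZ (fun k hk _ ↦ hoddY k hk) hevenY (fun k hk _ ↦ hoddZ k hk) hevenZ fun c hc t ht ↦ ?_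
  exact BettiUniverse.ofRatClass_crossMap_mem_algebraicClasses_of_finrank_hom_le_mul hHD hY hZ hc hs (halgY h) (halgZ h') hle ht

end Literature.AlgebraicGeometry.HodgeTheory

/-! ### §3 Pairs of even-dimensional smooth hypersurfaces -/

namespace Literature.AlgebraicGeometry.Motives.IsSmoothHypersurface

open Literature.AlgebraicGeometry.Motives
open Literature.AlgebraicGeometry.HodgeTheory

variable {m n e e' : ℕ} {Y Y' : SchemeOver ℂ}

/-- **`HC(Y × Y')` for smooth hypersurfaces `Y ⊂ ℙ^{2h+1}_ℂ`, `Y' ⊂ ℙ^{2h'+1}_ℂ` of EVEN dimensions with `HC(Y)`, `HC(Y')` and `dim_ℚ Hom_HS(H^{2h}Y, H^{2h'}Y'(h' − h)) ≤ ρ_h(Y) · ρ_{h'}(Y')`** (no exceptional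
morphism of Hodge structures between the middle cohomologies): hypersurfaces are off-middle algebraic without odd cohomology off the middle degree (Cor. 1.24/1.25, g29-#7), so §2 applies — e.g. two
quadrics, or two cubic fourfolds whose transcendental lattices admit no Hodge morphism. [cite: VoisinHodgeII2003, §1.2.3 Cor. 1.24 and Cor. 1.25] [cite: VoisinHodgeI2002, §11.3.3 Lemma 11.41 and p. 287] -/
theorem hodgeConjectureFor_tensor_hypersurface_of_even_of_even_of_finrank_hom_le_mul (hY : IsSmoothHypersurface m e Y) (hY' : IsSmoothHypersurface n e' Y') (hHD : exists_isReal_hodgeModel)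
    {h h' : ℕ} (hm : m = 2 * h) (hn : n = 2 * h') (hHC : HodgeConjectureFor m Y) (hHC' : HodgeConjectureFor n Y') (hs : (n : ℤ) - 2 * ((h' : ℤ) - h) = m)
    (hle : Module.finrank ℚ (HodgeStructure.Hom (BettiUniverse.hodge hHD hY.1 m) (((BettiUniverse.hodge hHD hY'.1 n).tateTwist ((h' : ℤ) - h)).cast hs)) ≤
      Module.finrank ℚ ↥((BettiUniverse.hodge hHD hY.1 m).hodgeClasses h) * Module.finrank ℚ ↥((BettiUniverse.hodge hHD hY'.1 n).hodgeClasses h')) :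
    HodgeConjectureFor (m + n) (Y ⊗ Y') :=
  BettiUniverse.hodgeConjectureFor_tensor_of_offMiddle_algebraic_of_finrank_hom_le_mul hHD hY.1 hY'.1 (hY.1.tensor_holds hY'.1) hHC hHC' hm hn
    (fun _ hk ↦ hY.finrank_bettiCohomology_eq_zero_of_odd hk fun hkm ↦ (Nat.not_even_iff_odd.2 hk) ⟨h, by omega⟩) (fun _ hp ↦ hY.hodgeClasses_hodge_eq_top_of_two_mul_ne hHD hY.1 hp)
    (fun _ hk ↦ hY'.finrank_bettiCohomology_eq_zero_of_odd hk fun hkn ↦ (Nat.not_even_iff_odd.2 hk) ⟨h', by omega⟩) (fun _ hp ↦ hY'.hodgeClasses_hodge_eq_top_of_two_mul_ne hHD hY'.1 hp) hs hle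

end Literature.AlgebraicGeometry.Motives.IsSmoothHypersurface

end
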